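import Mathlib
import Summits.Ventures.PercRepro2.Defs
import Summits.Ventures.PercRepro2.Graph
import Summits.Ventures.PercRepro2.OneColourSwitch
import Summits.Ventures.PercRepro2.RegionHubSign
import Summits.Ventures.PercRepro2.SideSwitch
import Summits.Ventures.PercRepro2.TermSwitchDefs
import Summits.Ventures.PercRepro2.M9NoPocketDefs
import Summits.Ventures.PercRepro2.M9GeneralDSplit
import Summits.Ventures.PercRepro2.M9FourParts
import Summits.Ventures.PercRepro2.M9ReachedSum
import Summits.Ventures.PercRepro2.M9ReachedK
import Summits.Ventures.PercRepro2.M9PsiOneDefs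
import Summits.Ventures.PercRepro2.M9PsiOneSum
import Summits.Ventures.PercRepro2.M9PsiOneRest
import Summits.Ventures.PercRepro2.M9TwoExHd

/-!
# The `3/2`-form with the payment built in: (REST3) (blind cell PercRepro2, p3 g33, 2026-08-28;
`proofs/P3-BSTAR.md` §9c)

Theorem Ψ₁ pays the positive doubly-reached sum `Σ_{exPlusSet} σ_pq = EX/2` ONCE with the
one-sided `K`-points `Ψ₁(exPlusSet)` (`exPlus_add_image_nonpos`, M9PsiOneSum).  The census says the
one-sided `K`-points pay it THREE times (`3·EX + 2·kOnly ≤ 0`, the `3/2`-form of M9TwoExHd):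
**(REST3)** `Σ_{kOnlySet ∖ Ψ₁(exPlusSet)} σ_pq σ_rs ≤ −2·Σ_{exPlusSet} σ_pq` — the one-sided
`K`-points NOT reserved by Ψ₁ pay twice more (once by the clean ones, `L_z + EX ≤ 0`, once by the
dirty ones — the open half of ⟦2EXHD⟧).  Proved here: `kOnlySum_eq_image_add_rest`
(`kOnly = Σ_{Ψ₁(exPlusSet)} + Σ_{rest}`), **`three_ex_add_two_kOnly_nonpos_of_rest3`**
((REST3) ⟹ `3·EX + 2·kOnly ≤ 0`), `dSignSum_nonpos_of_three_ex_add_two_kOnly` (the `3/2`-form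
⟹ the single-`d` statement, any class) and `dSignSum_nonpos_of_rest3`.  The Ψ₁ rows are
`T`-free (`hT`) and need no `r–s` edge (`hrs'`).  Own work; std axioms.
-/

namespace Summit.Ventures.PercRepro2

namespace NoPocket

open Finset Classical RegionHub OneColourSwitch SideSwitch TermSwitch

variable {V : Type*} {E : Type*}

section Rest3

variable [Fintype V] [DecidableEq V] [Fintype E] [DecidableEq E] {ends : E → Sym2 V}
  {p q r s d : V}

omit [Fintype V] [DecidableEq V] in
/-- The image of `Ψ₁` on `exPlusSet` lies in `kOnlySet`. -/
lemma image_exPlus_subset_kOnlySet :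
    (exPlusSet ends p q r s d).image (psiOne ends r s d) ⊆ kOnlySet ends p q r s d := by
  intro ω' hω'
  obtain ⟨ω, hω, rfl⟩ := Finset.mem_image.1 hω'
  obtain ⟨h1, h2, h3, h4⟩ := psiOne_mem_kOnly hω
  exact Finset.mem_filter.2 ⟨Finset.mem_univ _, h1, h2, h3, h4⟩

omit [Fintype V] [DecidableEq V] in
/-- **`kOnly = Σ_{Ψ₁(exPlusSet)} σσ + Σ_{kOnlySet ∖ Ψ₁(exPlusSet)} σσ`.** -/
theorem kOnlySum_eq_image_add_rest :
    kOnlySum ends p q r s d =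
      (∑ ω ∈ (exPlusSet ends p q r s d).image (psiOne ends r s d),
        sigma ends ω p q * sigma ends ω r s) +
      ∑ ω ∈ kOnlySet ends p q r s d \ (exPlusSet ends p q r s d).image (psiOne ends r s d),
        sigma ends ω p q * sigma ends ω r s := by
  rw [kOnlySum_eq_sum_kOnlySet, ← Finset.sum_sdiff (f := fun ω => sigma ends ω p q *
    sigma ends ω r s) (image_exPlus_subset_kOnlySet (ends := ends) (p := p) (q := q) (r := r)
    (s := s) (d := d))]
  ring

/-- **The `3/2`-form implies the single-`d` statement** for every non-mark `d ≠ r, s` (no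
`T`-free hypothesis): `dSignSum = N + 2·kOnly + EX ≤ N − 2·EX`, and for `EX < 0` REACH gives
`dSignSum ≤ EX + N`. -/
theorem dSignSum_nonpos_of_three_ex_add_two_kOnly (hr : d ≠ r) (hs : d ≠ s)
    (h : 3 * exSum ends p q r s d + 2 * kOnlySum ends p q r s d ≤ 0) :
    dSignSum ends p q r s d ≤ 0 := by
  have hN := unreachedSum_nonpos (ends := ends) (p := p) (q := q) (r := r) (s := s) (d := d)
  rcases le_or_gt (exSum ends p q r s d) 0 with hex | hex
  · have h1 := dSignSum_le_ex_add_unreached (ends := ends) (p := p) (q := q) hr hs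
    linarith
  · have h1 := dSignSum_eq_four_status (ends := ends) (p := p) (q := q) (r := r) (s := s) (d := d)
    have h2 := mOnlySum_eq_kOnlySum (ends := ends) (p := p) (q := q) (r := r) (s := s) (d := d)
    linarith

omit [Fintype V] [DecidableEq V] in
/-- **(REST3) ⟹ the `3/2`-form**: if the one-sided `K`-points outside `Ψ₁(exPlusSet)` sum to at
most `−2·Σ_{exPlusSet} σ_pq`, then `3·EX + 2·kOnly ≤ 0`. -/
theorem three_ex_add_two_kOnly_nonpos_of_rest3 (hT : ∀ e, ends e ≠ s(d, r) ∧ ends e ≠ s(d, s))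
    (hr : d ≠ r) (hs : d ≠ s) (hrs : r ≠ s) (hrs' : ∀ e, ends e ≠ s(r, s))
    (hrest : (∑ ω ∈ kOnlySet ends p q r s d \ (exPlusSet ends p q r s d).image (psiOne ends r s d),
        sigma ends ω p q * sigma ends ω r s) ≤
      -2 * ∑ ω ∈ exPlusSet ends p q r s d, sigma ends ω p q) :
    3 * exSum ends p q r s d + 2 * kOnlySum ends p q r s d ≤ 0 := by
  have h1 := exSum_eq_two_mul_exPlus (ends := ends) (p := p) (q := q) hT hr hs hrs
  have h2 := exPlus_add_image_nonpos (ends := ends) (p := p) (q := q) (d := d) hrs'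
  have h3 := kOnlySum_eq_image_add_rest (ends := ends) (p := p) (q := q) (r := r) (s := s) (d := d)
  linarith

/-- **The single-`d` statement from (REST3)** (no edge at `d` to `r, s`, no `r–s` edge). -/
theorem dSignSum_nonpos_of_rest3 (hT : ∀ e, ends e ≠ s(d, r) ∧ ends e ≠ s(d, s))
    (hr : d ≠ r) (hs : d ≠ s) (hrs : r ≠ s) (hrs' : ∀ e, ends e ≠ s(r, s))
    (hrest : (∑ ω ∈ kOnlySet ends p q r s d \ (exPlusSet ends p q r s d).image (psiOne ends r s d),
        sigma ends ω p q * sigma ends ω r s) ≤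
      -2 * ∑ ω ∈ exPlusSet ends p q r s d, sigma ends ω p q) :
    dSignSum ends p q r s d ≤ 0 :=
  dSignSum_nonpos_of_three_ex_add_two_kOnly hr hs
    (three_ex_add_two_kOnly_nonpos_of_rest3 hT hr hs hrs hrs' hrest)

end Rest3

end NoPocket

end Summit.Ventures.PercRepro2
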